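import Summits.NavierStokesRegularity.NavierStokesRegularity.Theorems.LerayQuarterDissipationFiniteDissipationLiouvilleCriticalPoint
import HarnessLib

/-!
# Crux `FiniteDissipationLiouville` (stmt-NavierStokesRegularity-22144): STABILITY OF REGULARITY
# along KNSS-convergent sequences of members of the stratum

Theorems file of route `LerayQuarterDissipation` (seat ns-lqd-p2 g7; `--supports` the crux; tool
for the envelope theorem of the critical element). Navier–Stokes regularity is NOT proved by
anything here; no summit is.

`𝒟_{C,K}`: Type-I ancient mild fields (KNSS gauge) with the law `∫ ‖∇w(s)‖² ≤ K/√(−s)`.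
ns-lqd-p1's `Compactness.persistent_singularity_seq` (p591803) says: if `w_k ∈ 𝒟_{C,K}` are singular
at the apex and converge uniformly on the slab pieces to `W`, then `W` is singular at the apex. This
file proves the same mechanism in its POSITIVE form, at an arbitrary centre:

* `eventually_bounded_of_limit_bounded` — if the limit `W` is bounded on a backward cylinder
  `(−r², 0) × B(0, r)` at the origin, then ALL BUT FINITELY MANY `w_k` are bounded, by a common
  bound, on a common smaller cylinder `(−ρ², 0) × B(0, ρ)` (zoom by a small factor `μ`: one slice
  of the zoomed limit is `ε₀/2`-small on `B(0, A)`; uniform convergence at that fixed negative time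
  makes the zoomed `w_k` slices `ε₀`-small for large `k`; the class's sup-norm ε-regularity
  `RecurrentReductionD.epsilon_regularity` bounds the zoomed `w_k` by `1` up to the final time);
* `tendstoUniformlyOn_pieces_translate` — uniform convergence on the slab pieces is inherited by
  spatial translates;
* `eventually_bounded_near_of_limit_bounded` — the same at any centre `x₀` (translation covariance of
  the stratum, `CriticalPoint.isTypeIAncientMild_translate` / `law_translate`).

In words: **regular final-time points of the limit are uniformly regular points of the tail of the
sequence** (upper semicontinuity of the singular set under KNSS convergence inside a stratum).

References: Koch–Nadirashvili–Seregin–Šverák, Acta Math. 203 (2009) = arXiv:0709.3599, §4 and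
Lemma 6.1; Albritton–Barker, arXiv:1811.00502, Prop. 2.3.
-/

noncomputable section

-- the summit and its single sub-problem share the name (CONVENTIONS §1), as in every Theorems file
set_option linter.dupNamespace false

namespace Summit.NavierStokesRegularity.NavierStokesRegularity.Theorems.FiniteDissipationLiouville.Stability

open MeasureTheory Set Filter Topology Metric Function
open Literature.Analysis Literature.Analysis.FluidPDE
open Summit.NavierStokesRegularity.NavierStokesRegularity.Theorems.FiniteDissipationLiouville
open scoped ENNReal NNReal

/-- **Stability of regularity at the origin.** Let `w k ∈ 𝒟_{C,K}` converge uniformly on every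
slab piece `[−(n+2), −1/(n+2)] × B̄(0, n+2)` to a Type-I ancient mild field `W` (constant `C`)
which is bounded by `M` on the backward cylinder `(−r², 0) × B(0, r)`. Then there are `ρ > 0` and
`B` such that `‖w k t x‖ ≤ B` on `(−ρ², 0) × B(0, ρ)` for all large `k`. (The proof of
`Compactness.persistent_singularity_seq`, run forwards.) [cite: KochNadirashviliSereginSverak2009, §4 (arXiv:0709.3599 p. 8)] -/
theorem eventually_bounded_of_limit_bounded {C K : ℝ}
    {w : ℕ → ℝ → EuclideanSpace ℝ (Fin 3) → EuclideanSpace ℝ (Fin 3)}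
    (hwk : ∀ k, IsTypeIAncientMild C (w k))
    (hlaw : ∀ k, ∀ s : ℝ, s < 0 →
      ∫⁻ x, ‖fderiv ℝ (w k s) x‖ₑ ^ 2 ≤ ENNReal.ofReal (K / Real.sqrt (-s)))
    {W : ℝ → EuclideanSpace ℝ (Fin 3) → EuclideanSpace ℝ (Fin 3)} (hW : IsTypeIAncientMild C W)
    (hunif : ∀ n : ℕ, TendstoUniformlyOn (fun k z => w k z.1 z.2) (fun z => W z.1 z.2)
      atTop (Icc (-((n : ℝ) + 2)) (-(1 / ((n : ℝ) + 2))) ×ˢ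
        closedBall (0 : EuclideanSpace ℝ (Fin 3)) ((n : ℝ) + 2)))
    {r Mb : ℝ} (hr : 0 < r)
    (hWb : ∀ t ∈ Ioo (-(r ^ 2)) (0 : ℝ), ∀ x ∈ ball (0 : EuclideanSpace ℝ (Fin 3)) r, ‖W t x‖ ≤ Mb) :
    ∃ ρ > 0, ∃ B : ℝ, ∀ᶠ k in atTop, ∀ t ∈ Ioo (-(ρ ^ 2)) (0 : ℝ),
      ∀ x ∈ ball (0 : EuclideanSpace ℝ (Fin 3)) ρ, ‖w k t x‖ ≤ B := by
  -- adapted from Theorems/…FiniteDissipationLiouvillePersistenceSeq.lean (`persistent_singularity_seq`)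
  obtain ⟨CS, hCS⟩ := RecurrentReductionD.eLpNorm_six_le_of_dissipationLaw
  set k₆ : ℝ := (CS : ℝ) * Real.sqrt (max K 0) with hk₆
  have hk₆0 : 0 ≤ k₆ := by rw [hk₆]; positivity
  obtain ⟨t₁, ht₁, A, hA, ε₀, hε₀, hER⟩ :=
    RecurrentReductionD.epsilon_regularity (k₆ := k₆) hW.nonneg hk₆0
  set s : ℝ := -t₁ with hs
  have hspos : 0 < s := by rw [hs]; exact neg_pos.2 ht₁
  -- `W` is bounded by `Mb' > 0` on the cylinder
  set Mb' : ℝ := max Mb 1 with hMb'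
  have hMb'pos : 0 < Mb' := lt_of_lt_of_le one_pos (le_max_right _ _)
  have hWb' : ∀ t ∈ Ioo (-(r ^ 2)) (0 : ℝ), ∀ x ∈ ball (0 : EuclideanSpace ℝ (Fin 3)) r,
      ‖W t x‖ ≤ Mb' := fun t ht x hx => (hWb t ht x hx).trans (le_max_left _ _)
  -- ## the zoom factor `μ`
  set Bc : ℝ := Mb' + A + Real.sqrt s + 1 with hB
  have hBpos : 0 < Bc := by rw [hB]; positivity
  set m : ℝ := min (min ε₀ r) 1 with hm
  have hmpos : 0 < m := by rw [hm]; exact lt_min (lt_min hε₀ hr) one_pos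
  have hmε : m ≤ ε₀ := (min_le_left _ _).trans (min_le_left _ _)
  have hmr : m ≤ r := (min_le_left _ _).trans (min_le_right _ _)
  have hm1 : m ≤ 1 := min_le_right _ _
  set μ : ℝ := m / (2 * Bc) with hμ
  have hμpos : 0 < μ := by rw [hμ]; positivity
  have hBne : Bc ≠ 0 := hBpos.ne'
  have hμB : μ * Bc = m / 2 := by rw [hμ]; field_simp
  have hμMb : μ * Mb' ≤ ε₀ / 2 := by
    have : μ * Mb' ≤ μ * Bc :=
      mul_le_mul_of_nonneg_left (by rw [hB]; have := Real.sqrt_nonneg s; linarith) hμpos.le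
    linarith
  have hμA : μ * A < r ∧ μ * A ≤ 1 / 2 := by
    have : μ * A ≤ μ * Bc - μ := by
      rw [← mul_sub_one]; refine mul_le_mul_of_nonneg_left ?_ hμpos.le
      rw [hB]; have := Real.sqrt_nonneg s; linarith
    constructor <;> linarith
  have hμs : μ * Real.sqrt s < r ∧ μ * Real.sqrt s ≤ 1 / 2 := by
    have : μ * Real.sqrt s ≤ μ * Bc - μ := by
      rw [← mul_sub_one]; refine mul_le_mul_of_nonneg_left ?_ hμpos.le
      rw [hB]; linarith
    constructor <;> linarith
  have hμ2s : μ ^ 2 * s < r ^ 2 ∧ μ ^ 2 * s ≤ 1 := by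
    have e : μ ^ 2 * s = (μ * Real.sqrt s) ^ 2 := by
      rw [mul_pow, Real.sq_sqrt hspos.le]
    have h0 : 0 ≤ μ * Real.sqrt s := by positivity
    rw [e]
    constructor
    · exact pow_lt_pow_left₀ hμs.1 h0 two_ne_zero
    · have h1 := mul_le_mul hμs.2 hμs.2 h0 (by norm_num)
      rw [sq]; linarith
  -- ## the slab piece containing the zoomed data region
  set n : ℕ := max (Nat.ceil (1 / (μ ^ 2 * s))) (Nat.ceil r) with hn
  have hn1 : 1 / (μ ^ 2 * s) ≤ (n : ℝ) + 2 := by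
    have : (Nat.ceil (1 / (μ ^ 2 * s)) : ℝ) ≤ n := by rw [hn]; exact_mod_cast le_max_left _ _
    have := Nat.le_ceil (1 / (μ ^ 2 * s)); linarith
  have hμ2spos : 0 < μ ^ 2 * s := by positivity
  have hpiece : ∀ y : EuclideanSpace ℝ (Fin 3), ‖y‖ ≤ A →
      ((μ ^ 2 * t₁, μ • y) : ℝ × EuclideanSpace ℝ (Fin 3)) ∈
        Icc (-((n : ℝ) + 2)) (-(1 / ((n : ℝ) + 2))) ×ˢ
          closedBall (0 : EuclideanSpace ℝ (Fin 3)) ((n : ℝ) + 2) := by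
    intro y hy
    refine ⟨⟨?_, ?_⟩, ?_⟩
    · have : μ ^ 2 * t₁ = -(μ ^ 2 * s) := by rw [hs]; ring
      rw [this]; have : (1 : ℝ) ≤ (n : ℝ) + 2 := by have := n.cast_nonneg (α := ℝ); linarith
      linarith [hμ2s.2]
    · have : μ ^ 2 * t₁ = -(μ ^ 2 * s) := by rw [hs]; ring
      rw [this, neg_le_neg_iff, div_le_iff₀ (by positivity : (0 : ℝ) < (n : ℝ) + 2)]
      rw [div_le_iff₀ hμ2spos] at hn1
      linarith
    · rw [mem_closedBall_zero_iff, norm_smul, Real.norm_of_nonneg hμpos.le]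
      have : μ * ‖y‖ ≤ μ * A := mul_le_mul_of_nonneg_left hy hμpos.le
      linarith [hμA.1]
  -- ## all large `k`: slices uniformly close to `W` on the piece
  have hδ : 0 < ε₀ / (2 * μ) := by positivity
  refine ⟨μ * min (Real.sqrt s) 1, by positivity, μ⁻¹, ?_⟩
  filter_upwards [(Metric.tendstoUniformlyOn_iff.1 (hunif n)) (ε₀ / (2 * μ)) hδ] with k hk
  -- ## the zoomed member `v = (w k)_μ` and its small slice
  set v : ℝ → EuclideanSpace ℝ (Fin 3) → EuclideanSpace ℝ (Fin 3) := nsRescale μ (w k) with hv_def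
  have hv : IsTypeIAncientMild C v := isTypeIAncientMild_nsRescale (hwk k) hμpos
  have hvlaw := RecurrentReductionD.dissipationLaw_nsRescale (hlaw k) hμpos
  have hvL6 : ∀ τ : ℝ, τ < 0 → eLpNorm (v τ) 6 volume ≤ ENNReal.ofReal (k₆ * (-τ) ^ (-(1 / 4 : ℝ))) :=
    fun τ hτ => hCS C K v hv hvlaw τ hτ
  have hvdata : ∀ y : EuclideanSpace ℝ (Fin 3), ‖y‖ ≤ A → ‖v t₁ y‖ ≤ ε₀ := by
    intro y hy
    have e : v t₁ y = μ • w k (μ ^ 2 * t₁) (μ • y) := by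
      rw [hv_def, nsRescale_apply]
    rw [e, norm_smul, Real.norm_of_nonneg hμpos.le]
    have hz := hk (μ ^ 2 * t₁, μ • y) (hpiece y hy)
    dsimp only at hz
    rw [dist_eq_norm] at hz
    have hzt : μ ^ 2 * t₁ ∈ Ioo (-(r ^ 2)) (0 : ℝ) := by
      have : μ ^ 2 * t₁ = -(μ ^ 2 * s) := by rw [hs]; ring
      rw [this]; exact ⟨by linarith [hμ2s.1], by linarith⟩
    have hzx : μ • y ∈ ball (0 : EuclideanSpace ℝ (Fin 3)) r := by
      rw [mem_ball_zero_iff, norm_smul, Real.norm_of_nonneg hμpos.le]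
      have : μ * ‖y‖ ≤ μ * A := mul_le_mul_of_nonneg_left hy hμpos.le
      linarith [hμA.1]
    have hWz := hWb' _ hzt _ hzx
    have h1 : ‖w k (μ ^ 2 * t₁) (μ • y)‖ ≤ Mb' + ε₀ / (2 * μ) := by
      have := norm_le_norm_sub_add (w k (μ ^ 2 * t₁) (μ • y)) (W (μ ^ 2 * t₁) (μ • y))
      rw [norm_sub_rev] at this
      linarith [hz.le]
    calc μ * ‖w k (μ ^ 2 * t₁) (μ • y)‖ ≤ μ * (Mb' + ε₀ / (2 * μ)) :=
          mul_le_mul_of_nonneg_left h1 hμpos.le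
      _ = μ * Mb' + ε₀ / 2 := by field_simp
      _ ≤ ε₀ := by linarith
  -- ## ε-regularity bounds `v` near the origin up to the final time; unzoom
  have hbound := hER v hv hvL6 hvdata
  intro t ht x hx
  have hρs : μ * min (Real.sqrt s) 1 ≤ μ * Real.sqrt s :=
    mul_le_mul_of_nonneg_left (min_le_left _ _) hμpos.le
  have hρ1 : μ * min (Real.sqrt s) 1 ≤ μ := by
    have := mul_le_mul_of_nonneg_left (min_le_right (Real.sqrt s) 1) hμpos.le
    rwa [mul_one] at this
  -- zoomed coordinates
  have hμ2 : 0 < μ ^ 2 := by positivity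
  have ht' : t / μ ^ 2 ∈ Ioo t₁ 0 := by
    refine ⟨?_, div_neg_of_neg_of_pos ht.2 hμ2⟩
    rw [show t₁ = -s by rw [hs]; ring, lt_div_iff₀ hμ2]
    have hmin : min (Real.sqrt s) 1 ^ 2 ≤ s := by
      have h0 : 0 ≤ min (Real.sqrt s) 1 := le_min (Real.sqrt_nonneg _) zero_le_one
      calc min (Real.sqrt s) 1 ^ 2 ≤ Real.sqrt s ^ 2 := pow_le_pow_left₀ h0 (min_le_left _ _) 2
        _ = s := Real.sq_sqrt hspos.le
    have h1 : (μ * min (Real.sqrt s) 1) ^ 2 ≤ μ ^ 2 * s := by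
      rw [mul_pow]; exact mul_le_mul_of_nonneg_left hmin hμ2.le
    nlinarith [ht.1]
  have hx' : ‖μ⁻¹ • x‖ < 2 := by
    rw [mem_ball_zero_iff] at hx
    rw [norm_smul, norm_inv, Real.norm_of_nonneg hμpos.le, inv_mul_lt_iff₀ hμpos]
    linarith
  have hb := hbound (t / μ ^ 2) ht' (μ⁻¹ • x) hx'
  have e : v (t / μ ^ 2) (μ⁻¹ • x) = μ • w k t x := by
    rw [hv_def, nsRescale_apply, mul_div_cancel₀ _ hμ2.ne', smul_smul, mul_inv_cancel₀ hμpos.ne',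
      one_smul]
  rw [e, norm_smul, Real.norm_of_nonneg hμpos.le] at hb
  have h2 := mul_le_mul_of_nonneg_left hb (inv_nonneg.2 hμpos.le)
  rwa [← mul_assoc, inv_mul_cancel₀ hμpos.ne', one_mul, mul_one] at h2

/-- **Uniform convergence on the slab pieces passes to spatial translates** (the piece `n` of
the translates by `x₀` lies in the piece `n + m` of the originals whenever `‖x₀‖ ≤ m`). [folklore] -/
theorem tendstoUniformlyOn_pieces_translate
    {w : ℕ → ℝ → EuclideanSpace ℝ (Fin 3) → EuclideanSpace ℝ (Fin 3)}
    {W : ℝ → EuclideanSpace ℝ (Fin 3) → EuclideanSpace ℝ (Fin 3)}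
    (hunif : ∀ n : ℕ, TendstoUniformlyOn (fun k z => w k z.1 z.2) (fun z => W z.1 z.2)
      atTop (Icc (-((n : ℝ) + 2)) (-(1 / ((n : ℝ) + 2))) ×ˢ
        closedBall (0 : EuclideanSpace ℝ (Fin 3)) ((n : ℝ) + 2)))
    (x₀ : EuclideanSpace ℝ (Fin 3)) :
    ∀ n : ℕ, TendstoUniformlyOn (fun k z => w k z.1 (x₀ + z.2)) (fun z => W z.1 (x₀ + z.2))
      atTop (Icc (-((n : ℝ) + 2)) (-(1 / ((n : ℝ) + 2))) ×ˢ
        closedBall (0 : EuclideanSpace ℝ (Fin 3)) ((n : ℝ) + 2)) := by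
  intro n
  obtain ⟨m, hm⟩ := exists_nat_ge ‖x₀‖
  set g : ℝ × EuclideanSpace ℝ (Fin 3) → ℝ × EuclideanSpace ℝ (Fin 3) := fun z => (z.1, x₀ + z.2)
    with hg
  have h : TendstoUniformlyOn (fun k z => w k z.1 (x₀ + z.2)) (fun z => W z.1 (x₀ + z.2)) atTop
      (g ⁻¹' (Icc (-(((n + m : ℕ) : ℝ) + 2)) (-(1 / (((n + m : ℕ) : ℝ) + 2))) ×ˢ
        closedBall (0 : EuclideanSpace ℝ (Fin 3)) (((n + m : ℕ) : ℝ) + 2))) :=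
    (hunif (n + m)).comp g
  refine h.mono ?_
  · intro z hz
    obtain ⟨⟨hz1, hz2⟩, hz3⟩ := hz
    rw [mem_closedBall_zero_iff] at hz3
    have hmn : ((n : ℝ) + 2) ≤ ((n + m : ℕ) : ℝ) + 2 := by push_cast; linarith [m.cast_nonneg (α := ℝ)]
    have hpos : (0 : ℝ) < (n : ℝ) + 2 := by positivity
    refine ⟨⟨?_, ?_⟩, ?_⟩
    · show -(((n + m : ℕ) : ℝ) + 2) ≤ z.1
      linarith
    · show z.1 ≤ -(1 / (((n + m : ℕ) : ℝ) + 2))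
      have : 1 / (((n + m : ℕ) : ℝ) + 2) ≤ 1 / ((n : ℝ) + 2) :=
        one_div_le_one_div_of_le hpos hmn
      linarith
    · show x₀ + z.2 ∈ closedBall (0 : EuclideanSpace ℝ (Fin 3)) (((n + m : ℕ) : ℝ) + 2)
      rw [mem_closedBall_zero_iff]
      refine (norm_add_le _ _).trans ?_
      push_cast; linarith

/-- **Stability of regularity at any centre.** As `eventually_bounded_of_limit_bounded`, for a
backward cylinder `(−r², 0) × B(x₀, r)` at an arbitrary point `x₀` (translation covariance of the
stratum). [cite: KochNadirashviliSereginSverak2009, §4 (arXiv:0709.3599 p. 8)] -/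
theorem eventually_bounded_near_of_limit_bounded {C K : ℝ}
    {w : ℕ → ℝ → EuclideanSpace ℝ (Fin 3) → EuclideanSpace ℝ (Fin 3)}
    (hwk : ∀ k, IsTypeIAncientMild C (w k))
    (hlaw : ∀ k, ∀ s : ℝ, s < 0 →
      ∫⁻ x, ‖fderiv ℝ (w k s) x‖ₑ ^ 2 ≤ ENNReal.ofReal (K / Real.sqrt (-s)))
    {W : ℝ → EuclideanSpace ℝ (Fin 3) → EuclideanSpace ℝ (Fin 3)} (hW : IsTypeIAncientMild C W)
    (hunif : ∀ n : ℕ, TendstoUniformlyOn (fun k z => w k z.1 z.2) (fun z => W z.1 z.2)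
      atTop (Icc (-((n : ℝ) + 2)) (-(1 / ((n : ℝ) + 2))) ×ˢ
        closedBall (0 : EuclideanSpace ℝ (Fin 3)) ((n : ℝ) + 2)))
    (x₀ : EuclideanSpace ℝ (Fin 3)) {r Mb : ℝ} (hr : 0 < r)
    (hWb : ∀ t ∈ Ioo (-(r ^ 2)) (0 : ℝ), ∀ x ∈ ball (0 : EuclideanSpace ℝ (Fin 3)) r,
      ‖W t (x₀ + x)‖ ≤ Mb) :
    ∃ ρ > 0, ∃ B : ℝ, ∀ᶠ k in atTop, ∀ t ∈ Ioo (-(ρ ^ 2)) (0 : ℝ),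
      ∀ x ∈ ball (0 : EuclideanSpace ℝ (Fin 3)) ρ, ‖w k t (x₀ + x)‖ ≤ B :=
  eventually_bounded_of_limit_bounded (w := fun k s y => w k s (x₀ + y))
    (fun k => CriticalPoint.isTypeIAncientMild_translate (hwk k) x₀)
    (fun k => CriticalPoint.law_translate (hlaw k) x₀)
    (CriticalPoint.isTypeIAncientMild_translate hW x₀)
    (tendstoUniformlyOn_pieces_translate hunif x₀) hr hWb

end Summit.NavierStokesRegularity.NavierStokesRegularity.Theorems.FiniteDissipationLiouville.Stability

end
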